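import Literature.MathematicalPhysics.QuantumFieldTheory.Balaban1983to89.B9PerturbationL2Letters
import Literature.MathematicalPhysics.QuantumFieldTheory.Balaban1983to89.B9PerturbationMajorantsAtLettersPhys

/-!
# `Balaban1983to89.B9PerturbationL2Delta2` — [B9] (3.135)∕(3.137) IN THE L² CLASS: Δ⁽²⁾_π = (1 − DRG′D\*)·Δ⁽²⁾·(1 − DG′RD\*) between the weighted block-L²
# classes FROM ONE LETTER ON THE RAW RESIDUAL Δ⁽²⁾ (the `t1` half of the N06 certificate's displayed `hstepL2`), and the coordinate factorization of
# def-Y's pinned model `T2coK` through a model `D2coK` of the raw residual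

T. Bałaban, *Propagators for lattice gauge theories in a background field*, Commun. Math. Phys. **99** (1985) 389–434 [`Balaban1985BackgroundPropagators`,
"B9"]; [4] = T. Bałaban, *Propagators and renormalization transformations for lattice gauge theories. II*, Commun. Math. Phys. **96** (1984) 223–250
[`Balaban1984PropagatorsII`].  statement-level skeleton of published theorems with citation tags; proofs where landed; nothing here is a claim about
the Yang–Mills mass gap.  Sequel of `B9PerturbationL2Letters` (the letters 𝒫, 𝒫†, 𝒯 = DRG′D\* in the 𝔩-classes and the `StepL2.t` shape of Δ′_π).

THE PRINT.  p. 422, (3.135): *"Δ⁽²⁾_π = Δ⁽²⁾ − DRG′D\*Δ⁽²⁾ − Δ⁽²⁾DG′RD\* + DRG′D\*Δ⁽²⁾DG′RD\*"*; p. 423, (3.137): *"|(Δ⁽²⁾A)(b)| ≦ O(1)Mα₀(Lʲη)⁻²|A|, b ∈ Δ(y), y ∈ Λ_j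
… This bound implies that the operators Δ⁽²⁾, Δ⁽²⁾_π are small in a proper sense"*; (3.138): G₁ = Σₙ G₀((Δ′_π + Δ⁽²⁾_π)G₀)ⁿ, *"The convergence is in all norms
appearing in the formulation of Theorem 3.3"* — in particular the L² norms (3.46).

THE POINT.  In the SUP class the right factor 1 − DG′RD\* of (3.135) is an order-zero operator of Calderón–Zygmund type, NOT uniformly bounded on raw sup inputs
(dag-n06-l STEP-SCHEMA-FORMS-MEMO §2, «U1»), so the certificate displays the Δ⁽²⁾ content through COMPOSITE sup letters `hta₂ ∕ htb₂ …`.  In the L² class both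
DG′RD\* and DRG′D\* ARE bounded (𝒯 = DRG′D\* = ϱ(∇G′∇\* − (∇P)(G′∇\*)), `B9PerturbationL2Letters.l2_DvRGpDvs`; its twin DG′RD\* here), hence Δ⁽²⁾_π = (1 − 𝒯)Δ⁽²⁾(1 − 𝒯ᵗ)
is bounded in block-L² from ONE letter on the RAW residual Δ⁽²⁾ : 𝔩^{(−1)} → 𝔩^{(1)} — (3.137) read in L² — with NO caveat.  THIS FILE:
* §1 (models, def-Y's letters BY NAME) `D2coK` = the coordinate model of the raw residual Δ⁽²⁾(U) at `T2coK`'s scaling `c⁻¹`; ★ `t2coK_phys_eq_sandwich` — at the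
  print-units letter `GpPhysY`, def-Y's pinned `T2coK` (= c⁻¹·coord(`delta2PiY` = `gaugePiTY ∘ Δ2 ∘ gaugePiY`)) IS `(1 − DvcoKH∘RcoK∘GcoS∘DvscoKH) ∘ D2coK ∘
  (1 − DvcoKH∘GcoS∘RcoK∘DvscoKH)` over the knit's letter models at `GpY` (n06-d's `coordOpK` functor calculus + `gcoS_GpPhysY ∕ rcoK_GpPhysY`; every `etaS` cancels);
* §2 (letter-generic) `l2_DvGpRDvs` (DG′RD\* : 𝔩^{(0)} → 𝔩^{(0)}, `constL2T`), ★★ `hasMaj_t2_l2_of_residual` ∕ `blockBd_t2_of_residual` — for T₂ = (1 − Dv∘R∘Gp∘Dvs) ∘ D₂ ∘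
  (1 − Dv∘Gp∘R∘Dvs) with D₂ : 𝔩^{(−1)} → 𝔩^{(1)} [θ₂]: T₂ : 𝔩^{(−1)} → 𝔩^{(1)} with `θ₂·constL2Pi·e^{−δ_T d}`, `constL2Pi = (1 + constL2T·L·c)²`, for 0 ≦ δ_T,
  δ_T + 3σ + 3αδ ≦ r ≦ min(δ₀, δ_P, δ₄) — from `Thm31GpMaj` (e1, e2), `Thm31GpL2Mixed`, `Proj349Maj` (p1, p2) and TWO transpose facts; read back as the block bound
  θ₂·constL2Pi·(Lʲη)⁻¹(L^{j′}η)⁻¹e^{−δ_T d} (the `𝔬.T2 U` input of `B9PerturbationL2Letters.stepL2_of_blockBd`).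
* §3 (v1.1, APPEND-ONLY) `isTransposePair_d2coK` (the model is self-transpose at `trBasis` when Δ⁽²⁾(U) is trace-symmetric — the certificate's `hΔ2`) and ★★
  `blockBd_d2coK_of_sup_symm`: the residual's block-L² letter `θ·(Lʲη)⁻¹(L^{j′}η)⁻¹e^{−δd}` FROM PRINT'S (3.137) AS A SUP MAJORANT `θ·(Lʲη)⁻²e^{−δd}` + `hΔ2`, by Schur.
HONEST SCOPE.  Kernel-checked bookkeeping; Theorem 3.1 (3.42)₂₃∕(3.46)₄ and (3.49)₂₃ are HYPOTHESIS SCHEMAS, the raw residual's L² letter is a hypothesis about a FREE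
parameter (inhabited trivially by the flat family Δ⁽²⁾ = 0, `d2coK_eq_zero`), nothing of [B9] or [4] asserted; count-neutral; N06 NOT discharged; one finite lattice at
a time — nothing continuum ∕ ℝ⁴ ∕ OS ∕ mass gap ∕ Clay.  Cell `pub-ymgap` (HUMAN RULING D-0062), Track A node N06 [B9], WIDTH-209 piece 4 (W-e `hstepL2`), seat
`pub-ymgap-dag-n06-w8` (g0), 2026-08-28.  NEW file; r06's `B9Delta2PiMajorant.hasMaj_dress` (the sup dress over ONE block-normed space, concrete 𝒞) is the
sup-class relative — different currency, not restated.
-/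

namespace Literature.MathematicalPhysics.QuantumFieldTheory.Balaban1983to89.B9PerturbationL2Delta2

open Node00 Node00.OpsYSectDCoords B9Thm312Whole B9Thm312WholeClasses
open B9PerturbationSplitAtLetters B9PerturbationMajorantAlgebra B9PerturbationMajorantsAtLetters B9PerturbationMajorantsAtLettersPhys
open B9PerturbationL2Algebra B9PerturbationL2Letters
open B6KLevelCensusIndexV1 (KIdx)
open B9CoReadingCoords B9CoReadingCoordsH B9CoReadingCoordsS
open B9Eq3132SectDLetters (gaugePiY gaugePiTY)
open B9Thm39ReadingCoords (cR39)
open B11SectG (BlockNorm HasMaj RowSum)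
open B9Thm34Ext (toB6)
open B9Thm37Glue (IsTransposePair)
open B9SectDL2Decay (BlockBd)
open B9RWSums343to347Whole (Facts347)
open B9Ineq349SiteComposite (etaS_pos)
open B9RWSums346Schur B9Ineq347

noncomputable section

/-! ## §1 The raw residual's coordinate model and the sandwich factorization of `T2coK` at `GpPhysY` -/

section Models

variable {𝔸 : Type} [NormedRing 𝔸] [NormedAlgebra ℂ 𝔸] [CompleteSpace 𝔸] [FiniteDimensional ℝ 𝔸]
variable {κ : Type} [Fintype κ]
variable {d ℓ : ℕ} {hd : 1 ≤ d + 1} {hL : Odd (ℓ + 1) ∧ 1 < ℓ + 1} {b₀ b₁ : ℝ} (i : KIdx d ℓ hd hL b₀ b₁)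
  (b : Module.Basis κ ℝ 𝔸) (B : B9.Backgrounds) (cfg : B.Cfg → CfgY 𝔸 i) (parS : SiteParY 𝔸 i) (Δ2 : BondOpY 𝔸 i)

/-- **THE COORDINATE MODEL OF THE RAW RESIDUAL Δ⁽²⁾(U)** (3.134) on the bond-sector carrier, scaled `c⁻¹` exactly like def-Y's `T2coK` (the model of
Δ⁽²⁾_π) — so that the L² ∕ sup letters of the FREE residual parameter `Δ2` can be displayed about Δ⁽²⁾ itself rather than about its dressed composites.
[cite: Balaban1985BackgroundPropagators, (3.134) p.422, (3.137) p.423] -/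
def D2coK (U₁ : B.Cfg) : (XBK κ i → ℝ) →ₗ[ℝ] (XBK κ i → ℝ) :=
  (cR39 b)⁻¹ • coordOpK b (fun _ : Fin (d + 1) => (Δ2 (cfg U₁)).restrictScalars ℝ)

omit [CompleteSpace 𝔸] [FiniteDimensional ℝ 𝔸] in
/-- `restrictScalars` through composition (definitional). [cite: Balaban1985BackgroundPropagators, (3.135) p.422, dictionary] -/
private theorem rS_comp {T₁ T₂ T₃ : Type} (f : (T₂ → 𝔸) →ₗ[ℂ] (T₃ → 𝔸)) (g : (T₁ → 𝔸) →ₗ[ℂ] (T₂ → 𝔸)) :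
    (f ∘ₗ g).restrictScalars ℝ = f.restrictScalars ℝ ∘ₗ g.restrictScalars ℝ := rfl

omit [CompleteSpace 𝔸] [FiniteDimensional ℝ 𝔸] in
/-- `restrictScalars` through differences (definitional). [cite: Balaban1985BackgroundPropagators, (3.135) p.422, dictionary] -/
private theorem rS_sub {T₁ T₂ : Type} (f g : (T₁ → 𝔸) →ₗ[ℂ] (T₂ → 𝔸)) :
    (f - g).restrictScalars ℝ = f.restrictScalars ℝ - g.restrictScalars ℝ := rfl

omit [CompleteSpace 𝔸] [FiniteDimensional ℝ 𝔸] in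
/-- `restrictScalars` of the identity (definitional). [cite: Balaban1985BackgroundPropagators, (3.135) p.422, dictionary] -/
private theorem rS_id {T₁ : Type} : (LinearMap.id : (T₁ → 𝔸) →ₗ[ℂ] (T₁ → 𝔸)).restrictScalars ℝ = LinearMap.id := rfl

omit [CompleteSpace 𝔸] [FiniteDimensional ℝ 𝔸] in
/-- `restrictScalars` of a real multiple written as a complex scalar. [cite: Balaban1985BackgroundPropagators, (3.25) p.394, dictionary] -/
private theorem rS_real_smul {T₁ T₂ : Type} (r : ℝ) (f : (T₁ → 𝔸) →ₗ[ℂ] (T₂ → 𝔸)) :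
    ((r : ℂ) • f).restrictScalars ℝ = r • f.restrictScalars ℝ := by
  ext x t
  simp only [LinearMap.restrictScalars_apply, LinearMap.smul_apply, Pi.smul_apply, Complex.coe_smul]

/-- the model of the zero residual is zero (the flat family `Δ⁽²⁾ = 0` inhabits every letter about `D2coK`). [cite: Balaban1985BackgroundPropagators, (3.134) p.422, bookkeeping] -/
theorem d2coK_eq_zero {U₁ : B.Cfg} (hΔ : Δ2 (cfg U₁) = 0) : D2coK i b B cfg Δ2 U₁ = 0 := by
  rw [D2coK, hΔ]
  have h := coordOpK_smul b (0 : ℝ) (fun _ : Fin (d + 1) => (0 : (FBondY i → 𝔸) →ₗ[ℝ] (FBondY i → 𝔸)))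
  simp only [zero_smul] at h
  change (cR39 b)⁻¹ • coordOpK b (fun _ : Fin (d + 1) => (0 : (FBondY i → 𝔸) →ₗ[ℝ] (FBondY i → 𝔸))) = 0
  rw [h, smul_zero]

/-- the site-propagator coordinate family at the print-units letter is `c⁻¹ × the knit's site model at the lattice letter`.
[cite: Balaban1985BackgroundPropagators, (3.25) p.394, (3.42) p.397; Balaban1984PropagatorsII, (2.67) p.234] -/
theorem coordOpK_GpPhysY (hc : cR39 b ≠ 0) (U₁ : B.Cfg) :
    coordOpK b (fun _ : Fin (d + 1) => (GpPhysY i parS (cfg U₁)).restrictScalars ℝ) = (cR39 b)⁻¹ • GcoS i b B cfg (GpY i parS) U₁ := by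
  have hη : etaS i ^ 2 ≠ 0 := pow_ne_zero 2 (etaS_pos i).ne'
  rw [GcoS, GpPhysY_apply, rS_real_smul, coordOpK_smul, smul_smul]
  rw [show (cR39 b)⁻¹ * (etaS i ^ 2 * cR39 b) = etaS i ^ 2 by field_simp]

/-- the `R(U)` coordinate family at the print-units letter is `c × RcoK` at the lattice letter. [cite: Balaban1985BackgroundPropagators, (3.25) p.394] -/
theorem coordOpK_RY_GpPhysY (hc : cR39 b ≠ 0) (U₁ : B.Cfg) :
    coordOpK b (fun _ : Fin (d + 1) => (RY i parS (GpPhysY i parS) (cfg U₁)).restrictScalars ℝ) = (cR39 b) • RcoK i b B cfg parS (GpY i parS) U₁ := by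
  rw [RcoK, RY_GpPhysY, smul_smul, mul_inv_cancel₀ hc, one_smul]

/-- ★ **THE SANDWICH FACTORIZATION OF def-Y's PINNED Δ⁽²⁾_π MODEL AT THE PRINT-UNITS LETTER**: `T2coK … (GpPhysY) Δ2 U = (1 − DvcoKH∘RcoK∘GcoS∘DvscoKH) ∘ D2coK Δ2 U ∘
(1 − DvcoKH∘GcoS∘RcoK∘DvscoKH)` (all propagator letters at `GpY`) — (3.135)'s `(1 − DRG′D\*) Δ⁽²⁾ (1 − DG′RD\*)` in coordinates, every units factor `etaS` cancelled.
[cite: Balaban1985BackgroundPropagators, (3.135) p.422, (3.25) p.394] -/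
theorem t2coK_phys_eq_sandwich (hc : cR39 b ≠ 0) (U₁ : B.Cfg) :
    T2coK i b B cfg parS (GpPhysY i parS) Δ2 U₁ =
      (1 - DvcoKH i b B cfg U₁ ∘ₗ RcoK i b B cfg parS (GpY i parS) U₁ ∘ₗ GcoS i b B cfg (GpY i parS) U₁ ∘ₗ DvscoKH i b B cfg U₁) ∘ₗ
        D2coK i b B cfg Δ2 U₁ ∘ₗ
        (1 - DvcoKH i b B cfg U₁ ∘ₗ GcoS i b B cfg (GpY i parS) U₁ ∘ₗ RcoK i b B cfg parS (GpY i parS) U₁ ∘ₗ DvscoKH i b B cfg U₁) := by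
  have hη : etaS i ^ 2 ≠ 0 := pow_ne_zero 2 (etaS_pos i).ne'
  have hsc : etaS i ^ 2 * cR39 b * (cR39 b)⁻¹ = etaS i ^ 2 := by field_simp
  -- the two gauge projections in coordinates: every scalar cancels to etaS² on both sides
  have hπ : coordOpK b (fun _ : Fin (d + 1) => (gaugePiY i parS (GpPhysY i parS) (cfg U₁)).restrictScalars ℝ) =
      1 - DvcoKH i b B cfg U₁ ∘ₗ GcoS i b B cfg (GpY i parS) U₁ ∘ₗ RcoK i b B cfg parS (GpY i parS) U₁ ∘ₗ DvscoKH i b B cfg U₁ := by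
    rw [gaugePiY, RY_GpPhysY, GpPhysY_apply, DvcoKH, DvscoKH, GcoS, RcoK]
    simp only [rS_sub, rS_id, rS_comp, rS_real_smul, LinearMap.comp_smul, LinearMap.smul_comp, smul_smul, coordOpK_const_sub, coordOpK_id,
      coordOpK_smul, coordOpK_const_comp_coordOpKH_const, coordOpKH_const_comp_coordOpKH_const, coordOpKH_eq_coordOpK, Module.End.one_eq_id]
    rw [show (cR39 b)⁻¹ * (etaS i ^ 2 * cR39 b) = etaS i ^ 2 by field_simp]
  have hπT : coordOpK b (fun _ : Fin (d + 1) => (gaugePiTY i parS (GpPhysY i parS) (cfg U₁)).restrictScalars ℝ) =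
      1 - DvcoKH i b B cfg U₁ ∘ₗ RcoK i b B cfg parS (GpY i parS) U₁ ∘ₗ GcoS i b B cfg (GpY i parS) U₁ ∘ₗ DvscoKH i b B cfg U₁ := by
    rw [gaugePiTY, RY_GpPhysY, GpPhysY_apply, DvcoKH, DvscoKH, GcoS, RcoK]
    simp only [rS_sub, rS_id, rS_comp, rS_real_smul, LinearMap.comp_smul, LinearMap.smul_comp, smul_smul, coordOpK_const_sub, coordOpK_id,
      coordOpK_smul, coordOpK_const_comp_coordOpKH_const, coordOpKH_const_comp_coordOpKH_const, coordOpKH_eq_coordOpK, Module.End.one_eq_id]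
    rw [hsc]
  rw [T2coK, delta2PiY, rS_comp, rS_comp, coordOpK_const_comp, coordOpK_const_comp, hπT, hπ, D2coK]
  simp only [LinearMap.smul_comp, LinearMap.comp_smul]

end Models

/-! ## §2 Δ⁽²⁾_π = (1 − DRG′D\*)·Δ⁽²⁾·(1 − DG′RD\*) between the L² classes from ONE letter on the raw residual -/

section Letters

variable {g : B9.Geometry} {XS XB : Type} [Fintype XS] [Fintype XB] [Fintype g.Site] {R₀ : ℝ} {H₀ : Prop}
variable {blkW : XS → g.Site} {blk : XB → g.Site} {Gp P R : Module.End ℝ (XS → ℝ)} {Dv : (XS → ℝ) →ₗ[ℝ] (XB → ℝ)}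
  {Dvs : (XB → ℝ) →ₗ[ℝ] (XS → ℝ)} {B₀ δ₀ CP δP B₄ δ₄ r ϱ σ c : ℝ} {dF : ℕ} {δ α L₀ : ℝ}

/-- the dressing constant of Δ⁽²⁾_π in the L² classes: (1 + T·L·c)² with T = `constL2T` (the size of DRG′D\* ∕ DG′RD\*).
[cite: Balaban1985BackgroundPropagators, (3.135) p.422 (bookkeeping)] -/
def constL2Pi (ϱ B₀ CP B₄ c L : ℝ) : ℝ := (1 + constL2T ϱ B₀ CP B₄ c L * L * c) ^ 2

omit [Fintype g.Site] in
/-- `constL2Pi ≥ 0` (a square). [cite: Balaban1985BackgroundPropagators, (3.135) p.422 (bookkeeping)] -/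
theorem constL2Pi_nonneg (ϱ B₀ CP B₄ c L : ℝ) : 0 ≤ constL2Pi ϱ B₀ CP B₄ c L := sq_nonneg _

/-- ★ **THE TRANSPOSED MIXED LETTER 𝒯ᵗ = DG′RD\* : 𝔩^{(0)} → 𝔩^{(0)}**: DG′RD\* = ϱ(∇G′∇\* − (∇G′)(P∇\*)) — Theorem 3.1's L² line (3.46)₄ and (3.46)₁ after
(3.49)₃ (one half-power transfer); majorant `constL2T·e^{−(r−σ−αδ)d}` — print's `1 − π` of (3.119)∕(3.135), bounded in L² (NOT on raw sup inputs: dag-n06-l U1).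
[cite: Balaban1985BackgroundPropagators, (3.135) p.422, (3.119) p.419, (3.46) p.398, (3.49) p.399; Balaban1984PropagatorsII, (2.54)+(2.61), (2.60) p.234] -/
theorem l2_DvGpRDvs (hG : GeoOK g) (hF : Facts347 g R₀ H₀ dF δ α L₀) (hrow : RowSum (toB6 g R₀ H₀) σ c)
    (hMix : HasMaj (l2R R₀ H₀ blk hG.lenle 0) (l2R R₀ H₀ blk hG.lenle 0) (Dv ∘ₗ Gp ∘ₗ Dvs) (fun a b => B₄ * Real.exp (-(r * g.dist a b))))
    (hDvGp : HasMaj (l2R R₀ H₀ blkW hG.lenle (1 / 2)) (l2R R₀ H₀ blk hG.lenle (-(1 / 2))) (Dv ∘ₗ Gp)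
      (fun a b => B₀ * Real.exp (-(r * g.dist a b))))
    (hPDvs : HasMaj (l2R R₀ H₀ blk hG.lenle (-(1 / 2))) (l2R R₀ H₀ blkW hG.lenle (1 / 2)) (P ∘ₗ Dvs)
      (fun a b => CP * Real.exp (-(r * g.dist a b))))
    (hR : R = ϱ • (LinearMap.id - P)) (hϱ : 0 ≤ ϱ) (hB₀ : 0 ≤ B₀) (hCP : 0 ≤ CP) (hB₄ : 0 ≤ B₄) (hc : 0 ≤ c) (hσ : 0 ≤ σ) (hτ : 0 ≤ α * δ)
    (hbud : 0 ≤ r - σ - α * δ) :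
    HasMaj (l2R R₀ H₀ blk hG.lenle 0) (l2R R₀ H₀ blk hG.lenle 0) (Dv ∘ₗ Gp ∘ₗ R ∘ₗ Dvs)
      (fun a b => constL2T ϱ B₀ CP B₄ c g.L * Real.exp (-((r - σ - α * δ) * g.dist a b))) := by
  have hL1 : 1 ≤ g.L := hF.one_le_L
  have hL0 : 0 ≤ g.L := le_trans zero_le_one hL1
  -- (∇G′)(P∇\*) : 𝔩^{(−1/2)} → 𝔩^{(−1/2)}, constant B₀C_Pc, rate r − σ; shifted by +1/2 to 𝔩^{(0)} → 𝔩^{(0)}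
  have h2 := hasMaj_comp_l2R hG hrow hB₀ hCP (show 0 ≤ r - σ by linarith) (show r - σ ≤ r by linarith)
    (show r - σ + σ ≤ r by linarith) hDvGp hPDvs
  have h2' := hasMaj_shift_l2R_nat hG hF ((1 / 2) : ℝ) 1 (by norm_num) (by norm_num) (mul_nonneg (mul_nonneg hB₀ hCP) hc) h2
  rw [pow_one, show -((1 : ℝ) / 2) + 1 / 2 = 0 by norm_num] at h2'
  have h1' := hasMaj_weaken hG hB₄ le_rfl (show r - σ - α * δ ≤ r by linarith) hMix
  have hsm := (hasMaj_smul_l2R (hasMaj_sub_exp h1' h2') ϱ).congr (T' := Dv ∘ₗ Gp ∘ₗ R ∘ₗ Dvs) fun μ => by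
    simp only [hR, LinearMap.smul_apply, LinearMap.sub_apply, LinearMap.comp_apply, LinearMap.id_apply, map_smul, map_sub]
  refine hsm.mono fun a b => ?_
  show |ϱ| * ((B₄ + B₀ * CP * c * g.L) * Real.exp (-((r - σ - α * δ) * g.dist a b))) ≤
    constL2T ϱ B₀ CP B₄ c g.L * Real.exp (-((r - σ - α * δ) * g.dist a b))
  rw [abs_of_nonneg hϱ, ← mul_assoc]
  exact mul_le_mul_of_nonneg_right (le_of_eq (by unfold constL2T; ring)) (Real.exp_nonneg _)

/-- ★★ **Δ⁽²⁾_π IN THE L² CLASSES FROM ONE LETTER ON THE RAW RESIDUAL**: for T₂ = (1 − Dv∘R∘Gp∘Dvs) ∘ D₂ ∘ (1 − Dv∘Gp∘R∘Dvs) ((3.135): Δ⁽²⁾_π =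
(1 − DRG′D\*)Δ⁽²⁾(1 − DG′RD\*)) with D₂ : 𝔩^{(−1)} → 𝔩^{(1)} carrying θ₂·e^{−δ₂d} ((3.137) in L²: ‖1_{Δ(y)}Δ⁽²⁾μ‖₂ ≦ θ₂(Lʲη)⁻¹(L^{j′}η)⁻¹e^{−δ₂d}‖μ‖₂),
T₂ : 𝔩^{(−1)} → 𝔩^{(1)} with `θ₂·constL2Pi·e^{−δ_T d}` for every 0 ≦ δ_T with δ_T + 3σ + 3αδ ≦ r ≦ min(δ₀, δ_P, δ₄, δ₂) — from Theorem 3.1 (3.42)₂₃ (`Thm31GpMaj`)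
+ (3.46)₄ (`Thm31GpL2Mixed`), (3.49)₂₃ (`Proj349Maj`), the two transpose facts (∇G′, G′∇\*), (∇P, P∇\*), the row sum at σ and the member facts: the four
terms of (3.135) composed in the 𝔩-classes ([4] (2.54)) with 𝒯 = DRG′D\* shifted to 𝔩^{(1)} → 𝔩^{(1)} and 𝒯ᵗ = DG′RD\* to 𝔩^{(−1)} → 𝔩^{(−1)}.
[cite: Balaban1985BackgroundPropagators, (3.135) p.422, (3.137)–(3.138) p.423, (3.46) p.398, (3.49) p.399; Balaban1984PropagatorsII, (2.54), (2.60)–(2.61) pp.233–234] -/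
theorem hasMaj_t2_l2_of_residual (hG : GeoOK g) (hF : Facts347 g R₀ H₀ dF δ α L₀) (hrow : RowSum (toB6 g R₀ H₀) σ c)
    (h31 : Thm31GpMaj blkW blk Gp Dv Dvs R₀ H₀ B₀ δ₀) (h4 : Thm31GpL2Mixed blk Gp Dv Dvs R₀ H₀ B₄ δ₄)
    (h49 : Proj349Maj blkW blk P Dv Dvs R₀ H₀ CP δP) (hDG : IsTransposePair (Dv ∘ₗ Gp) (Gp ∘ₗ Dvs))
    (hDP : IsTransposePair (Dv ∘ₗ P) (P ∘ₗ Dvs)) (hR : R = ϱ • (LinearMap.id - P))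
    {T2 D2 : Module.End ℝ (XB → ℝ)} {θ₂ δ₂ δT : ℝ}
    (hD2 : BlockBd (g := toB6 g R₀ H₀) blk blk D2 (fun (y y' : g.Site) => θ₂ * (g.len y)⁻¹ * (g.len y')⁻¹ * Real.exp (-(δ₂ * g.dist y y'))))
    (hT2 : T2 = (1 - Dv ∘ₗ R ∘ₗ Gp ∘ₗ Dvs) ∘ₗ D2 ∘ₗ (1 - Dv ∘ₗ Gp ∘ₗ R ∘ₗ Dvs))
    (hϱ : 0 ≤ ϱ) (hB₀ : 0 ≤ B₀) (hCP : 0 ≤ CP) (hB₄ : 0 ≤ B₄) (hθ₂ : 0 ≤ θ₂) (hc : 0 ≤ c) (hσ : 0 ≤ σ) (hτ : 0 ≤ α * δ)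
    (hr₀ : r ≤ δ₀) (hrP : r ≤ δP) (hr₄ : r ≤ δ₄) (hr₂ : r ≤ δ₂) (hδT₀ : 0 ≤ δT) (hδT : δT + 3 * σ + 3 * (α * δ) ≤ r) :
    HasMaj (l2R R₀ H₀ blk hG.lenle (-1)) (l2R R₀ H₀ blk hG.lenle 1) T2
      (fun a b => θ₂ * constL2Pi ϱ B₀ CP B₄ c g.L * Real.exp (-(δT * g.dist a b))) := by
  have hL1 : 1 ≤ g.L := hF.one_le_L
  have hL0 : 0 ≤ g.L := le_trans zero_le_one hL1
  have hTc : 0 ≤ constL2T ϱ B₀ CP B₄ c g.L := constL2T_nonneg hϱ hB₀ hCP hB₄ hc hL0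
  -- the raw residual between 𝔩^{(−1)} and 𝔩^{(1)}, at the common rate r
  have hD2r : BlockBd (g := toB6 g R₀ H₀) blk blk D2
      (fun (a b : g.Site) => θ₂ * Real.exp (-(δ₂ * g.dist a b)) * g.len a ^ (-1 : ℝ) * g.len b ^ (-1 : ℝ)) :=
    hD2.mono fun y y' => le_of_eq (by rw [Real.rpow_neg_one, Real.rpow_neg_one]; ring)
  have hD := hasMaj_l2R_of_blockBd hG (-1 : ℝ) (-1 : ℝ) hD2r
  rw [neg_neg] at hD
  have hD' := hasMaj_weaken hG hθ₂ le_rfl hr₂ hD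
  -- the letters at the common rate r, the two order-zero letters, shifted to 𝔩^{(1)} → 𝔩^{(1)} and 𝔩^{(−1)} → 𝔩^{(−1)}
  have hGpDvs := gpDvs_l2 hG h31 hDG hB₀ hr₀
  have hDvGp := dvGp_l2 hG h31 hDG hB₀ hr₀
  have hPDvs := pDvs_l2 hG h49 hDP hCP hrP
  have hDvP := dvP_l2 hG h49 hDP hCP hrP
  have hMix := dvGpDvs_l2 hG h4 hB₄ hr₄
  have hT := l2_DvRGpDvs hG hF hrow hMix hGpDvs hDvP hR hϱ hB₀ hCP hB₄ hc hσ hτ (by linarith)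
  have hTt := l2_DvGpRDvs hG hF hrow hMix hDvGp hPDvs hR hϱ hB₀ hCP hB₄ hc hσ hτ (by linarith)
  have hT1 := hasMaj_shift_l2R_nat hG hF (1 : ℝ) 1 (by norm_num) (by norm_num) hTc hT
  rw [pow_one, show (0 : ℝ) + 1 = 1 by norm_num] at hT1
  have hTm := hasMaj_shift_l2R_nat hG hF (-1 : ℝ) 1 (by norm_num) (by norm_num) hTc hTt
  rw [pow_one, show (0 : ℝ) + -1 = -1 by norm_num] at hTm
  -- the three dressed terms
  have nTL : 0 ≤ constL2T ϱ B₀ CP B₄ c g.L * g.L := mul_nonneg hTc hL0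
  have ha := hasMaj_comp_l2R hG hrow nTL hθ₂ (show 0 ≤ r - 2 * σ - 2 * (α * δ) by linarith) (show r - 2 * σ - 2 * (α * δ) ≤ r by linarith)
    (show r - 2 * σ - 2 * (α * δ) + σ ≤ r - σ - α * δ - α * δ by linarith) hT1 hD'
  have hb := hasMaj_comp_l2R hG hrow hθ₂ nTL (show 0 ≤ r - 2 * σ - 2 * (α * δ) by linarith)
    (show r - 2 * σ - 2 * (α * δ) ≤ r - σ - α * δ - α * δ by linarith) (show r - 2 * σ - 2 * (α * δ) + σ ≤ r by linarith) hD' hTm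
  have na : 0 ≤ constL2T ϱ B₀ CP B₄ c g.L * g.L * θ₂ * c := mul_nonneg (mul_nonneg nTL hθ₂) hc
  have hd := hasMaj_comp_l2R hG hrow na nTL (show 0 ≤ r - 3 * σ - 2 * (α * δ) by linarith)
    (show r - 3 * σ - 2 * (α * δ) ≤ r - σ - α * δ - α * δ by linarith) (show r - 3 * σ - 2 * (α * δ) + σ ≤ r - 2 * σ - 2 * (α * δ) by linarith) ha hTm
  -- the four terms at the common rate r − 3σ − 2αδ
  have nb : 0 ≤ θ₂ * (constL2T ϱ B₀ CP B₄ c g.L * g.L) * c := mul_nonneg (mul_nonneg hθ₂ nTL) hc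
  have hD'' := hasMaj_weaken hG hθ₂ le_rfl (show r - 3 * σ - 2 * (α * δ) ≤ r by linarith) hD'
  have ha' := hasMaj_weaken hG na le_rfl (show r - 3 * σ - 2 * (α * δ) ≤ r - 2 * σ - 2 * (α * δ) by linarith) ha
  have hb' := hasMaj_weaken hG nb le_rfl (show r - 3 * σ - 2 * (α * δ) ≤ r - 2 * σ - 2 * (α * δ) by linarith) hb
  have hsum := (((hasMaj_sub_exp hD'' ha').sub hb').add hd).congr (T' := T2) fun μ => by
    simp only [hT2, LinearMap.add_apply, LinearMap.sub_apply, LinearMap.comp_apply, Module.End.one_apply, map_sub]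
    abel
  refine hsum.mono fun a b => ?_
  have hdnn : 0 ≤ g.dist a b := hG.dnn a b
  have hexp : Real.exp (-((r - 3 * σ - 2 * (α * δ)) * g.dist a b)) ≤ Real.exp (-(δT * g.dist a b)) :=
    Real.exp_le_exp.mpr (neg_le_neg (mul_le_mul_of_nonneg_right (by linarith) hdnn))
  have hK : θ₂ + constL2T ϱ B₀ CP B₄ c g.L * g.L * θ₂ * c + θ₂ * (constL2T ϱ B₀ CP B₄ c g.L * g.L) * c +
      constL2T ϱ B₀ CP B₄ c g.L * g.L * θ₂ * c * (constL2T ϱ B₀ CP B₄ c g.L * g.L) * c = θ₂ * constL2Pi ϱ B₀ CP B₄ c g.L := by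
    unfold constL2Pi; ring
  show (θ₂ + constL2T ϱ B₀ CP B₄ c g.L * g.L * θ₂ * c) * Real.exp (-((r - 3 * σ - 2 * (α * δ)) * g.dist a b)) +
      θ₂ * (constL2T ϱ B₀ CP B₄ c g.L * g.L) * c * Real.exp (-((r - 3 * σ - 2 * (α * δ)) * g.dist a b)) +
      constL2T ϱ B₀ CP B₄ c g.L * g.L * θ₂ * c * (constL2T ϱ B₀ CP B₄ c g.L * g.L) * c * Real.exp (-((r - 3 * σ - 2 * (α * δ)) * g.dist a b)) ≤
    θ₂ * constL2Pi ϱ B₀ CP B₄ c g.L * Real.exp (-(δT * g.dist a b))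
  rw [← add_mul, ← add_mul, hK]
  exact mul_le_mul_of_nonneg_left hexp (mul_nonneg hθ₂ (constL2Pi_nonneg _ _ _ _ _ _))

/-- ★★ **THE BLOCK-L² BOUND OF Δ⁽²⁾_π FROM THE RAW RESIDUAL — the `𝔬.T2 U` input of `B9PerturbationL2Letters.stepL2_of_blockBd`**: under the hypotheses of
`hasMaj_t2_l2_of_residual`, ‖1_{Δ(y)}T₂μ‖₂ ≦ θ₂·constL2Pi·(Lʲη)⁻¹·(L^{j′}η)⁻¹·e^{−δ_T d(y,y′)}‖μ‖₂ for supp μ ⊂ Δ(y′).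
[cite: Balaban1985BackgroundPropagators, (3.135) p.422, (3.137)–(3.138) p.423, (3.46) p.398; Balaban1984PropagatorsII, (2.54), (2.60)–(2.61) pp.233–234] -/
theorem blockBd_t2_of_residual (hG : GeoOK g) (hF : Facts347 g R₀ H₀ dF δ α L₀) (hrow : RowSum (toB6 g R₀ H₀) σ c)
    (h31 : Thm31GpMaj blkW blk Gp Dv Dvs R₀ H₀ B₀ δ₀) (h4 : Thm31GpL2Mixed blk Gp Dv Dvs R₀ H₀ B₄ δ₄)
    (h49 : Proj349Maj blkW blk P Dv Dvs R₀ H₀ CP δP) (hDG : IsTransposePair (Dv ∘ₗ Gp) (Gp ∘ₗ Dvs))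
    (hDP : IsTransposePair (Dv ∘ₗ P) (P ∘ₗ Dvs)) (hR : R = ϱ • (LinearMap.id - P))
    {T2 D2 : Module.End ℝ (XB → ℝ)} {θ₂ δ₂ δT : ℝ}
    (hD2 : BlockBd (g := toB6 g R₀ H₀) blk blk D2 (fun (y y' : g.Site) => θ₂ * (g.len y)⁻¹ * (g.len y')⁻¹ * Real.exp (-(δ₂ * g.dist y y'))))
    (hT2 : T2 = (1 - Dv ∘ₗ R ∘ₗ Gp ∘ₗ Dvs) ∘ₗ D2 ∘ₗ (1 - Dv ∘ₗ Gp ∘ₗ R ∘ₗ Dvs))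
    (hϱ : 0 ≤ ϱ) (hB₀ : 0 ≤ B₀) (hCP : 0 ≤ CP) (hB₄ : 0 ≤ B₄) (hθ₂ : 0 ≤ θ₂) (hc : 0 ≤ c) (hσ : 0 ≤ σ) (hτ : 0 ≤ α * δ)
    (hr₀ : r ≤ δ₀) (hrP : r ≤ δP) (hr₄ : r ≤ δ₄) (hr₂ : r ≤ δ₂) (hδT₀ : 0 ≤ δT) (hδT : δT + 3 * σ + 3 * (α * δ) ≤ r) :
    BlockBd (g := toB6 g R₀ H₀) blk blk T2
      (fun (y y' : g.Site) => θ₂ * constL2Pi ϱ B₀ CP B₄ c g.L * (g.len y)⁻¹ * (g.len y')⁻¹ * Real.exp (-(δT * g.dist y y'))) := by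
  have h := blockBd_of_hasMaj_l2R hG (hasMaj_t2_l2_of_residual hG hF hrow h31 h4 h49 hDG hDP hR hD2 hT2 hϱ hB₀ hCP hB₄ hθ₂ hc hσ hτ
    hr₀ hrP hr₄ hr₂ hδT₀ hδT)
  refine h.mono fun y y' => le_of_eq ?_
  rw [Real.rpow_neg_one, Real.rpow_neg_one]
  ring

end Letters

/-! ## §3 (v1.1) (3.137) in block-L² FROM (3.137) AS PRINTED and the symmetry of Δ⁽²⁾ — Schur, no transfer, no rate loss -/

section SchurResidual

open scoped Matrix.Norms.L2Operator

variable {N : ℕ} {d ℓ : ℕ} {hd : 1 ≤ d + 1} {hL : Odd (ℓ + 1) ∧ 1 < ℓ + 1} {b₀ b₁ : ℝ} (i : KIdx d ℓ hd hL b₀ b₁)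
  (B : B9.Backgrounds) (cfg : B.Cfg → CfgY (Matrix (Fin N) (Fin N) ℂ) i) (Δ2 : BondOpY (Matrix (Fin N) (Fin N) ℂ) i)
variable {g : B9.Geometry} [Fintype g.Site] {R₀ : ℝ} {H₀ : Prop}

/-- a transpose pair scaled on both sides by the same real is a transpose pair. [folklore] -/
private theorem isTransposePair_smul_smul' {X Y : Type} [Fintype X] [Fintype Y] {A : (X → ℝ) →ₗ[ℝ] (Y → ℝ)} {A' : (Y → ℝ) →ₗ[ℝ] (X → ℝ)}
    (h : IsTransposePair A A') (r : ℝ) : IsTransposePair (r • A) (r • A') := by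
  intro u v
  simp only [LinearMap.smul_apply, Pi.smul_apply, smul_eq_mul]
  calc ∑ y, r * A u y * v y = r * ∑ y, A u y * v y := by rw [Finset.mul_sum]; exact Finset.sum_congr rfl fun y _ => by ring
    _ = r * ∑ x, u x * A' v x := by rw [h u v]
    _ = ∑ x, u x * (r * A' v x) := by rw [Finset.mul_sum]; exact Finset.sum_congr rfl fun x _ => by ring

/-- **the raw residual's model is its own transpose** over the trace basis when `Δ⁽²⁾(U)` is trace-symmetric (the certificate's displayed `hΔ2`, a THEOREM for
def-Y's genuine `delta2OfY` at unitary `U`: `Node00.resYOfC2_Δ2_isSymmTr`). [cite: Balaban1985BackgroundPropagators, (3.134) p.422, p.391 (L² adjoints)] -/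
theorem isTransposePair_d2coK (U₁ : B.Cfg) (hΔ : B9Thm311ReadingCoords.IsSymmTr (fun _ => (1 : ℝ)) (Δ2 (cfg U₁))) :
    IsTransposePair (D2coK i (B9CoReadingCoordsTranspose.trBasis N) B cfg Δ2 U₁) (D2coK i (B9CoReadingCoordsTranspose.trBasis N) B cfg Δ2 U₁) := by
  unfold D2coK
  exact isTransposePair_smul_smul'
    (B9CoReadingCoordsTranspose.isTransposePair_coordOpK_of_isSymmTr (B9CoReadingCoordsTranspose.trBasis N)
      (B9CoReadingCoordsTranspose.trBasis_repr_eq_trace N) _ hΔ) _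

/-- ★★ **(3.137) IN BLOCK-L² FROM (3.137) AS PRINTED AND THE SYMMETRY OF Δ⁽²⁾**: if the raw residual's model has print's sup majorant *"|(Δ⁽²⁾A)(b)| ≦
O(1)Mα₀(Lʲη)⁻²|A|, b ∈ Δ(y), y ∈ Λ_j"* in [4]-(2.51) block form `θ·(Lʲη)⁻²·e^{−δd(y,y′)}` (power at the OUTPUT block) and `Δ⁽²⁾(U)` is trace-symmetric, then
Schur's test (`B9PerturbationL2Algebra.blockBd_of_transposePair`, p = q = −2) gives the block-L² bound `θ·(Lʲη)⁻¹·(L^{j′}η)⁻¹·e^{−δd}` — the residual letter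
`hD2L2` of the N06 certificate (ed. 29) costs EXACTLY the printed sup line (3.137) plus the displayed `hΔ2`, at any residual; no scale transfer, no rate loss.
[cite: Balaban1985BackgroundPropagators, (3.137) p.423, (3.46) p.398, p.391; Balaban1984PropagatorsII, (2.51) p.232] -/
theorem blockBd_d2coK_of_sup_symm (hG : GeoOK g) {blk : XBK (B9CoReadingCoordsTranspose.TrIdx N) i → g.Site} {U₁ : B.Cfg} {θ δ₂ : ℝ} (hθ : 0 ≤ θ)
    (hsup : B6RandomWalk.HasMajorant (g := toB6 g R₀ H₀) blk (D2coK i (B9CoReadingCoordsTranspose.trBasis N) B cfg Δ2 U₁)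
      (fun (a b : g.Site) => θ * (g.len a ^ 2)⁻¹ * Real.exp (-(δ₂ * g.dist a b))))
    (hΔ : B9Thm311ReadingCoords.IsSymmTr (fun _ => (1 : ℝ)) (Δ2 (cfg U₁))) :
    BlockBd (g := toB6 g R₀ H₀) blk blk (D2coK i (B9CoReadingCoordsTranspose.trBasis N) B cfg Δ2 U₁)
      (fun (y y' : g.Site) => θ * (g.len y)⁻¹ * (g.len y')⁻¹ * Real.exp (-(δ₂ * g.dist y y'))) := by
  have hT : B6RandomWalkHom.HasMajorantHom (g := toB6 g R₀ H₀) blk blk (D2coK i (B9CoReadingCoordsTranspose.trBasis N) B cfg Δ2 U₁)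
      (fun (a b : g.Site) => θ * g.len a ^ (-2 : ℝ) * Real.exp (-(δ₂ * g.dist a b))) :=
    B6RandomWalkHom.hasMajorantHom_mono (g := toB6 g R₀ H₀) blk blk
      ((B6RandomWalkHom.hasMajorantHom_iff (g := toB6 g R₀ H₀) blk _ _).mpr hsup) fun a b => le_of_eq (by
        rw [Real.rpow_neg (hG.lenle a), ← Real.rpow_natCast]; norm_num)
  have h := blockBd_of_transposePair hG hθ hT hT (isTransposePair_d2coK i B cfg Δ2 U₁ hΔ)
  refine h.mono fun y y' => le_of_eq ?_
  rw [show (-2 : ℝ) / 2 = -1 by norm_num, Real.rpow_neg_one, Real.rpow_neg_one]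

end SchurResidual

end

end Literature.MathematicalPhysics.QuantumFieldTheory.Balaban1983to89.B9PerturbationL2Delta2
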